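import Literature.Probability.LatticeModels.NVectorAnisotropicGaussianDomination
import HarnessLib

/-!
# The infrared bound for `ν`-vector models with DIRECTION-DEPENDENT nearest-neighbour couplings
# (Fröhlich–Israel–Lieb–Simon 1978, §4, (4.6)–(4.10), Thm. 4.7; Friedli–Velenik 2017, Thm. 10.24)

Topic `Probability/LatticeModels`, namespace `Literature.Probability.LatticeModels.NVector`.
Sequel of `NVectorAnisotropicGaussianDomination.lean` (Gaussian domination `Z_K(h) ≤ Z_K(0)` for
the anisotropic nearest-neighbour `ν`-vector model on the even torus, `wvZ_le_wvZ_zero`) and the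
direction-dependent analogue of the tree's isotropic `FriedliVelenik2017_nVector_infraredBound_holds`
(`NVectorInfraredBoundProofs.lean`). The model: spins `S_x ∈ ℝ^ν` on `(ℤ/Lℤ)^d` with
`ℋ_K = ∑_{(x,i)} K_i ‖S_{x+eᵢ} - S_x‖₂²` (`nVectorHamiltonianK`; a coupling `K_i ≥ 0` per lattice
direction, inverse temperature absorbed), single-spin measure `ρ` (nonzero, finite, compactly
supported), Gibbs distribution `μ_K = Z_K⁻¹e^{-ℋ_K}⊗ρ` (`nVectorGibbsK`). PROVED here:

1. `integral_weight_wvecGradForm_sq_le` — the second-order consequence (10.46)–(10.47) of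
   Gaussian domination for a weighted bond form: `2∫ e^{-𝓔_W(ω)}𝓔_W(ω,h)² ≤ 𝓔_W(h,h)Z_W(0)`;
2. `anisoDispersion K p = ∑ᵢ K_i(1 - cos pᵢ)` — the ANISOTROPIC DISPERSION `E_p` of FILS 1978
   (Thm. 4.7: "`E_p` depending on `J_{αγ}`"; Kennedy–Lieb–Shastry's
   `E^r_q = 2 - cos q₁ - cos q₂ + r(1 - cos q₃)` for `K = (1,1,r)`), with
   `wgradFormC_torusChar_fun` (`𝓔_K(f, χ_k) = 2E_K(p_k)∑_x f_xχ_k(x)`), `wgradNormSq_torusChar`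
   (`∑_{(x,i)}K_i|χ_k(x+eᵢ) - χ_k(x)|² = 2L^dE_K(p_k)`), positivity on nonzero lattice momenta;
3. `weighted_mode_bound_aniso` — `4E_K(p_k)∫ e^{-𝓔_K}|∑_xω^a_xχ_k(x)|² ≤ L^d Z_K(0)`;
4. **`nVectorK_infraredBound`** — (1) for every mode with `E_K(p_k) > 0`:
   `|𝕋_L|⁻¹⟨‖∑_x e^{-ip·x}S_x‖²⟩_K ≤ ν/(4E_K(p_k))` (FILS (4.6) `g_Λ(p) ≤ (2βE_p)⁻¹`, in FV's
   normalisation); (2) for `K_i > 0` and unit spins: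
   `⟨‖m_L‖²⟩_K ≥ 1 - (ν/4)|𝕋_L|⁻¹∑_{k≠0}E_K(p_k)⁻¹` (FILS (4.10)).

For `K ≡ β` these are literally the two clauses of `FriedliVelenik2017_nVector_infraredBound`.
The layered plane rotator (`ν = 2`, `d = 3`, `K = (J∥,J∥,J⊥)/2` in this normalisation) is treated
in `AnisotropicPlaneRotatorInfraredFloor.lean`.

## References

* J. Fröhlich, R. Israel, E. H. Lieb, B. Simon, *Phase transitions and reflection positivity. I*,
  Comm. Math. Phys. 62 (1978) 1–34, §4, (4.6)–(4.10), Thms. 4.6–4.7 (Lieb, *Statistical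
  Mechanics* (Selecta), pp. 211–212, read) [FILS1978].
* S. Friedli, Y. Velenik, *Statistical Mechanics of Lattice Systems*, CUP (2017), §10.5.2–10.5.3,
  (10.39)–(10.47), Thm. 10.24 (pp. 501–507, read) [FriedliVelenik2017].
* T. Kennedy, E. H. Lieb, B. S. Shastry, J. Stat. Phys. 53 (1988) 1019–1030, eq. (7) [KLS1988JSP].
-/

noncomputable section

open MeasureTheory Filter Topology Finset
open scoped Real

namespace Literature.Probability.LatticeModels

namespace NVector

/-! ### The second-order consequence of Gaussian domination, weighted ((10.46)–(10.47)) -/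

section SecondOrder

variable {V : Type*} [Fintype V] {G : SimpleGraph V} [DecidableRel G.Adj] {ν : ℕ}
  {W : Sym2 V → ℝ} (ρ : Measure (Fin ν → ℝ))

/-- `Z_W(t h)` expanded around the configuration: with `w(ω) = e^{-𝓔_W(ω,ω)}` and
`A_h(ω) = 𝓔_W(ω,h)`, `Z_W(th) = e^{-t²𝓔_W(h,h)} ∫ w(ω) e^{-2t A_h(ω)} dμ₀`
(Friedli–Velenik 2017, proof of Thm. 10.24, "elementary computations").
[cite: FriedliVelenik2017, §10.5.3, proof of Thm. 10.24] -/
theorem wvZ_smul (t : ℝ) (h : V → Fin ν → ℝ) :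
    wvZ G W ρ (t • h) = Real.exp (-(t ^ 2 * wvecGradForm G W h h)) *
      ∫ ω, Real.exp (-wvecGradForm G W ω ω) * Real.exp (-(2 * t * wvecGradForm G W ω h))
        ∂(Measure.pi fun _ : V => ρ) := by
  unfold wvZ
  rw [← integral_const_mul]
  refine integral_congr_ae (ae_of_all _ fun ω => ?_)
  simp only
  rw [wvecGradForm_add_smul_self, ← Real.exp_add, ← Real.exp_add]
  congr 1
  ring

/-- `Z_W(0) = ∫ w dμ₀`. [cite: FriedliVelenik2017, §10.5.3, display before Prop. 10.27] -/
theorem wvZ_zero :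
    wvZ G W ρ 0 = ∫ ω, Real.exp (-wvecGradForm G W ω ω) ∂(Measure.pi fun _ : V => ρ) := by
  unfold wvZ
  simp only [add_zero]

variable [IsFiniteMeasure ρ]

/-- **The second-order consequence of Gaussian domination, weighted form** (Friedli–Velenik 2017,
proof of Thm. 10.24, (10.46)–(10.47); Fröhlich–Israel–Lieb–Simon 1978, (4.6)): if
`Z_W(th) ≤ Z_W(0)` for all real `t`, then `2 ∫ w(ω) 𝓔_W(ω,h)² dμ₀ ≤ 𝓔_W(h,h) ∫ w dμ₀` with
`w(ω) = e^{-𝓔_W(ω,ω)}`. As in the tree's isotropic file: `Z(th) + Z(-th) ≤ 2Z(0)` and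
`e^x + e^{-x} ≥ 2 + x²`, then a first-order expansion in `t²`.
[cite: FriedliVelenik2017, §10.5.3, proof of Thm. 10.24, (10.46)–(10.47)] -/
theorem integral_weight_wvecGradForm_sq_le {S : Set (Fin ν → ℝ)} (hSc : IsCompact S)
    (hS : ρ Sᶜ = 0) (hρ : ρ ≠ 0) (hW : ∀ e, 0 ≤ W e) (h : V → Fin ν → ℝ)
    (hGD : ∀ t : ℝ, wvZ G W ρ (t • h) ≤ wvZ G W ρ 0) :
    2 * ∫ ω, Real.exp (-wvecGradForm G W ω ω) * wvecGradForm G W ω h ^ 2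
        ∂(Measure.pi fun _ : V => ρ) ≤
      wvecGradForm G W h h * ∫ ω, Real.exp (-wvecGradForm G W ω ω) ∂(Measure.pi fun _ : V => ρ) := by
  set μ₀ : Measure (V → Fin ν → ℝ) := Measure.pi fun _ : V => ρ with hμ₀
  set w : (V → Fin ν → ℝ) → ℝ := fun ω => Real.exp (-wvecGradForm G W ω ω) with hw
  set A : (V → Fin ν → ℝ) → ℝ := fun ω => wvecGradForm G W ω h with hA
  set B : ℝ := wvecGradForm G W h h with hB
  set Z₀ : ℝ := ∫ ω, w ω ∂μ₀ with hZ₀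
  set T : ℝ := ∫ ω, w ω * A ω ^ 2 ∂μ₀ with hT
  show 2 * T ≤ B * Z₀
  have hwc : Continuous w := (continuous_wvecGradForm_self (G := G) (W := W)).neg.rexp
  have hAc : Continuous A := continuous_wvecGradForm_left (G := G) (W := W) h
  have hint : ∀ {f : (V → Fin ν → ℝ) → ℝ}, Continuous f → Integrable f μ₀ := fun hf =>
    integrable_pi_of_continuous ρ hSc hS hf
  have hw_pos : ∀ ω, 0 < w ω := fun ω => Real.exp_pos _
  have hZ₀_pos : 0 < Z₀ := by
    have := wvZ_pos (G := G) (W := W) hρ hW (0 : V → Fin ν → ℝ)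
    rwa [wvZ_zero] at this
  have hT0 : 0 ≤ T := integral_nonneg fun ω => mul_nonneg (hw_pos ω).le (sq_nonneg _)
  have hB0 : 0 ≤ B := wvecGradForm_self_nonneg hW h
  have hZ0 : wvZ G W ρ 0 = Z₀ := wvZ_zero ρ
  -- the lower bound `Z(th) + Z(-th) ≥ e^{-t²B} (2Z₀ + 4t² T)`
  have hlow : ∀ t : ℝ, Real.exp (-(t ^ 2 * B)) * (2 * Z₀ + 4 * t ^ 2 * T) ≤
      wvZ G W ρ (t • h) + wvZ G W ρ ((-t) • h) := by
    intro t
    rw [wvZ_smul, wvZ_smul, show (-t) ^ 2 = t ^ 2 by ring, ← mul_add]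
    refine mul_le_mul_of_nonneg_left ?_ (Real.exp_pos _).le
    have hi1 : Integrable (fun ω => w ω * Real.exp (-(2 * t * A ω))) μ₀ := hint (by fun_prop)
    have hi2 : Integrable (fun ω => w ω * Real.exp (-(2 * -t * A ω))) μ₀ := hint (by fun_prop)
    have hi3 : Integrable (fun ω => w ω * (2 + (2 * t * A ω) ^ 2)) μ₀ := hint (by fun_prop)
    rw [← integral_add hi1 hi2]
    calc 2 * Z₀ + 4 * t ^ 2 * T = ∫ ω, w ω * (2 + (2 * t * A ω) ^ 2) ∂μ₀ := by
          rw [hZ₀, hT, ← integral_const_mul, ← integral_const_mul, ← integral_add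
            ((hint hwc).const_mul _) ((hint (by fun_prop)).const_mul _)]
          refine integral_congr_ae (ae_of_all _ fun ω => ?_)
          simp only
          ring
      _ ≤ ∫ ω, w ω * Real.exp (-(2 * t * A ω)) + w ω * Real.exp (-(2 * -t * A ω)) ∂μ₀ := by
          refine integral_mono hi3 (hi1.add hi2) fun ω => ?_
          simp only
          rw [← mul_add]
          refine mul_le_mul_of_nonneg_left ?_ (hw_pos ω).le
          have e2 : -(2 * -t * A ω) = 2 * t * A ω := by ring
          rw [e2, add_comm (Real.exp _)]
          exact two_add_sq_le_exp_add_exp_neg _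
  -- hence `Z₀ + 2 T u ≤ Z₀ e^{Bu}` for `u ≥ 0`
  have hphi : ∀ u : ℝ, 0 ≤ u → Z₀ + 2 * T * u ≤ Z₀ * Real.exp (B * u) := by
    intro u hu
    have h1 := (hlow (Real.sqrt u)).trans (add_le_add (hGD _) (hGD _))
    rw [Real.sq_sqrt hu, hZ0] at h1
    have hexp : Real.exp (-(u * B)) * Real.exp (B * u) = 1 := by
      rw [← Real.exp_add]; convert Real.exp_zero using 2; ring
    have h2 := mul_le_mul_of_nonneg_right h1 (Real.exp_pos (B * u)).le
    have h3 : Real.exp (-(u * B)) * (2 * Z₀ + 4 * u * T) * Real.exp (B * u) =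
        2 * (Z₀ + 2 * T * u) := by
      calc Real.exp (-(u * B)) * (2 * Z₀ + 4 * u * T) * Real.exp (B * u)
          = (2 * Z₀ + 4 * u * T) * (Real.exp (-(u * B)) * Real.exp (B * u)) := by ring
        _ = 2 * (Z₀ + 2 * T * u) := by rw [hexp]; ring
    rw [h3] at h2
    linarith
  -- first-order expansion at `u = 0`
  by_contra hcon
  push Not at hcon
  have hlt : Z₀ * B < 2 * T := by nlinarith
  have hderiv : HasDerivAt (fun u : ℝ => Z₀ * Real.exp (B * u)) (Z₀ * B) 0 := by
    have h1 : HasDerivAt (fun u : ℝ => B * u) B 0 := by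
      simpa using (hasDerivAt_id (0 : ℝ)).const_mul B
    have h2 := (Real.hasDerivAt_exp (B * 0)).comp 0 h1
    simp only [mul_zero, Real.exp_zero, one_mul] at h2
    simpa using h2.const_mul Z₀
  rw [hasDerivAt_iff_tendsto_slope_zero] at hderiv
  have hev : ∀ᶠ u : ℝ in 𝓝[>] 0, u⁻¹ * (Z₀ * Real.exp (B * u) - Z₀) < 2 * T := by
    have ht := hderiv.mono_left (nhdsGT_le_nhdsNE 0)
    simp only [zero_add, mul_zero, Real.exp_zero, mul_one, smul_eq_mul] at ht
    exact ht.eventually (gt_mem_nhds hlt)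
  obtain ⟨u, hu, hupos⟩ := (hev.and self_mem_nhdsWithin).exists
  have hupos' : (0 : ℝ) < u := hupos
  have h3 := hphi u hupos'.le
  have h4 : Z₀ * Real.exp (B * u) - Z₀ < 2 * T * u := by
    have := (inv_mul_lt_iff₀ hupos').1 hu
    linarith
  linarith

end SecondOrder

/-! ### Plane waves on the torus with the anisotropic dispersion `E_K(p) = ∑ᵢ K_i (1 - cos pᵢ)` -/

section PlaneWaves

open _root_.Complex
open scoped ComplexConjugate

variable {d : ℕ}

/-- **The anisotropic dispersion** `E_K(p) = ∑ᵢ K_i (1 - cos pᵢ)` of Fröhlich–Israel–Lieb–Simon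
1978, §4 (Thm. 4.4/4.7: "`E_p` depending on `J_{αγ}`"; for `K ≡ 1` the tree's `dispersion`;
for `K = (1, 1, r)` Kennedy–Lieb–Shastry's `E^r_q = 2 - cos q₁ - cos q₂ + r(1 - cos q₃)`).
[cite: FILS1978, §4, (4.6)–(4.7) and Thm. 4.7] -/
def anisoDispersion (K : Fin d → ℝ) (p : Fin d → ℝ) : ℝ :=
  ∑ i, K i * (1 - Real.cos (p i))

/-- The anisotropic dispersion is nonnegative for nonnegative couplings.
[cite: FILS1978, §4, (4.7)] -/
theorem anisoDispersion_nonneg {K : Fin d → ℝ} (hK : ∀ i, 0 ≤ K i) (p : Fin d → ℝ) :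
    0 ≤ anisoDispersion K p :=
  Finset.sum_nonneg fun i _ => mul_nonneg (hK i) (sub_nonneg.2 (Real.cos_le_one _))

/-- For a constant coupling vector the anisotropic dispersion is `J` times the tree's
`dispersion`. [cite: FILS1978, §4, (4.7)] -/
theorem anisoDispersion_const (J : ℝ) (p : Fin d → ℝ) :
    anisoDispersion (fun _ => J) p = J * dispersion p := by
  unfold anisoDispersion dispersion
  rw [Finset.mul_sum]

/-- Domination by the weakest direction: `(minᵢ K_i)·ε(p) ≤ E_K(p)`, here in the form
`J ≤ K_i` for all `i` implies `J·ε(p) ≤ E_K(p)`. [cite: FILS1978, §4, (4.7)] -/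
theorem mul_dispersion_le_anisoDispersion {K : Fin d → ℝ} {J : ℝ} (hJ : ∀ i, J ≤ K i)
    (p : Fin d → ℝ) : J * dispersion p ≤ anisoDispersion K p := by
  unfold anisoDispersion dispersion
  rw [Finset.mul_sum]
  exact Finset.sum_le_sum fun i _ =>
    mul_le_mul_of_nonneg_right (hJ i) (sub_nonneg.2 (Real.cos_le_one _))

/-- On lattice momenta the anisotropic dispersion with POSITIVE couplings vanishes only at
`k = 0`: `E_K(2πk/L) > 0` for `k ≠ 0`. [cite: FILS1978, §4, (4.6) (`p ≠ 0`)] -/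
theorem anisoDispersion_latticeMomentum_pos {L : ℕ} [NeZero L] {K : Fin d → ℝ}
    (hK : ∀ i, 0 < K i) {k : TorusSite d L} (hk : k ≠ 0) :
    0 < anisoDispersion K (latticeMomentum L k) := by
  classical
  obtain ⟨J, hJpos, hJle⟩ : ∃ J : ℝ, 0 < J ∧ ∀ i, J ≤ K i := by
    by_cases hd : (Finset.univ : Finset (Fin d)).Nonempty
    · obtain ⟨i₀, -, hi₀⟩ := Finset.exists_min_image Finset.univ K hd
      exact ⟨K i₀, hK i₀, fun i => hi₀ i (Finset.mem_univ i)⟩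
    · refine ⟨1, one_pos, fun i => absurd ⟨i, Finset.mem_univ i⟩ hd⟩
  have hε : 0 < dispersion (latticeMomentum L k) := lt_of_le_of_ne (dispersion_nonneg _)
    (fun h => hk ((dispersion_latticeMomentum_eq_zero_iff_holds k).1 h.symm))
  exact lt_of_lt_of_le (mul_pos hJpos hε) (mul_dispersion_le_anisoDispersion hJle _)

variable {L : ℕ} [NeZero L]

/-- The weighted complexified bond form `∑_{{x,y}} W_{x,y}(f_x - f_y)(g_x - g_y)` for real `f`
and complex `g` (Friedli–Velenik 2017, proof of Thm. 10.24, "it also extends to any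
`h ∈ (ℂ^ν)^{𝕋_L}`"). [cite: FriedliVelenik2017, §10.5.3, proof of Thm. 10.24] -/
def wgradFormC {V : Type*} [Fintype V] (G : SimpleGraph V) [DecidableRel G.Adj]
    (W : Sym2 V → ℝ) (f : V → ℝ) (g : V → ℂ) : ℂ :=
  ∑ e ∈ G.edgeFinset, (W e : ℂ) * Sym2.lift ⟨fun x y => ((f x - f y : ℝ) : ℂ) * (g x - g y),
    fun x y => by push_cast; ring⟩ e

/-- **`𝓔_K(f, χ_k) = 2E_K(p_k) ∑_x f_x χ_k(x)`** for a real function `f` on the torus and the plane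
wave `χ_k`, with the anisotropic dispersion (Friedli–Velenik 2017, proof of Thm. 10.24, with a
coupling per direction: `∑_{(x,i)} K_i (f_x - f_{x+eᵢ})(χ_x - χ_{x+eᵢ}) = ∑ᵢ K_i|1 - e^{ipᵢ}|² ∑_x f_x χ_x`).
[cite: FILS1978, §4, Thm. 4.7 (`E_p` depending on `J_{αγ}`)] -/
theorem wgradFormC_torusChar_fun (hL : 3 ≤ L) (K : Fin d → ℝ) (k : TorusSite d L)
    (f : TorusSite d L → ℝ) :
    wgradFormC (torusGraph d L) (bondWeight K) f (torusChar k) =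
      ((2 * anisoDispersion K (latticeMomentum L k) : ℝ) : ℂ) * ∑ x, (f x : ℂ) * torusChar k x := by
  classical
  have hL2 : 2 ≤ L := by omega
  unfold wgradFormC
  rw [sum_edgeFinset_torusGraph hL]
  simp only [Sym2.lift_mk]
  simp_rw [bondWeight_mk_add_single hL]
  set M : ℂ := ∑ x, (f x : ℂ) * torusChar k x with hM
  set u : Fin d → ℂ := fun i => Complex.exp (latticeMomentum L k i * I) with hu
  have hχ : ∀ x i, torusChar k (x + Pi.single i 1) = torusChar k x * u i := fun x i => by
    rw [torusChar_add_right, torusChar_single hL2]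
  have hshift : ∀ i, ∑ x, (f (x + Pi.single i 1) : ℂ) * torusChar k x = conj (u i) * M := by
    intro i
    rw [hM, Finset.mul_sum, ← Equiv.sum_comp (Equiv.addRight (Pi.single i 1))
      (fun x => conj (u i) * ((f x : ℂ) * torusChar k x))]
    refine Finset.sum_congr rfl fun x _ => ?_
    simp only [Equiv.coe_addRight, hχ]
    have hu1 : conj (u i) * u i = 1 := by
      rw [mul_comm, Complex.mul_conj, hu]
      simp [Complex.normSq_eq_norm_sq, Complex.norm_exp_ofReal_mul_I]
    calc (f (x + Pi.single i 1) : ℂ) * torusChar k x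
        = (f (x + Pi.single i 1) : ℂ) * torusChar k x * (conj (u i) * u i) := by rw [hu1, mul_one]
      _ = conj (u i) * ((f (x + Pi.single i 1) : ℂ) * (torusChar k x * u i)) := by ring
  have hterm : ∀ x i, (((f x - f (x + Pi.single i 1) : ℝ)) : ℂ) *
      (torusChar k x - torusChar k (x + Pi.single i 1)) =
        (1 - u i) * ((f x : ℂ) * torusChar k x) -
          (1 - u i) * ((f (x + Pi.single i 1) : ℂ) * torusChar k x) := by
    intro x i; rw [hχ]; push_cast; ring
  have hi : ∀ i, ∑ x, ((K i : ℝ) : ℂ) * ((((f x - f (x + Pi.single i 1) : ℝ)) : ℂ) *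
      (torusChar k x - torusChar k (x + Pi.single i 1))) =
        (K i : ℂ) * ((1 - u i) * (1 - conj (u i))) * M := by
    intro i
    rw [← Finset.mul_sum]
    calc ((K i : ℝ) : ℂ) * ∑ x, (((f x - f (x + Pi.single i 1) : ℝ)) : ℂ) *
          (torusChar k x - torusChar k (x + Pi.single i 1))
        = (K i : ℂ) * ∑ x, ((1 - u i) * ((f x : ℂ) * torusChar k x) -
            (1 - u i) * ((f (x + Pi.single i 1) : ℂ) * torusChar k x)) := by
          rw [Finset.sum_congr rfl fun x _ => hterm x i]
      _ = (K i : ℂ) * ((1 - u i) * ∑ x, (f x : ℂ) * torusChar k x -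
            (1 - u i) * ∑ x, (f (x + Pi.single i 1) : ℂ) * torusChar k x) := by
          rw [Finset.sum_sub_distrib, Finset.mul_sum, Finset.mul_sum]
      _ = (K i : ℂ) * ((1 - u i) * M - (1 - u i) * (conj (u i) * M)) := by rw [hshift]
      _ = (K i : ℂ) * ((1 - u i) * (1 - conj (u i))) * M := by ring
  have hsum : ∑ i, (K i : ℂ) * ((1 - u i) * (1 - conj (u i))) =
      ((2 * anisoDispersion K (latticeMomentum L k) : ℝ) : ℂ) := by
    unfold anisoDispersion
    push_cast
    rw [Finset.mul_sum]
    refine Finset.sum_congr rfl fun i _ => ?_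
    have := one_sub_mul_one_sub_conj_exp (latticeMomentum L k i)
    rw [hu]
    push_cast at this ⊢
    rw [this]
    ring
  rw [Finset.sum_comm]
  calc ∑ i, ∑ x, ((K i : ℝ) : ℂ) * ((((f x - f (x + Pi.single i 1) : ℝ)) : ℂ) *
        (torusChar k x - torusChar k (x + Pi.single i 1)))
      = ∑ i, (K i : ℂ) * ((1 - u i) * (1 - conj (u i))) * M := Finset.sum_congr rfl fun i _ => hi i
    _ = (∑ i, (K i : ℂ) * ((1 - u i) * (1 - conj (u i)))) * M := by rw [Finset.sum_mul]
    _ = ((2 * anisoDispersion K (latticeMomentum L k) : ℝ) : ℂ) * M := by rw [hsum]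

/-- **`∑_{{x,y}} W_{x,y}‖χ_k(x) - χ_k(y)‖² = 2 L^d E_K(p_k)`** on the torus with
direction-dependent couplings (Friedli–Velenik 2017, proof of Thm. 10.24, the computation of
`∑‖h_i - h_j‖²`, with `K_i` per direction). [cite: FILS1978, §4, Thm. 4.7] -/
theorem wgradNormSq_torusChar (hL : 3 ≤ L) (K : Fin d → ℝ) (k : TorusSite d L) :
    ∑ e ∈ (torusGraph d L).edgeFinset, bondWeight K e *
        Sym2.lift ⟨fun x y => ‖torusChar k x - torusChar k y‖ ^ 2, fun x y => by
          show ‖torusChar k x - torusChar k y‖ ^ 2 = ‖torusChar k y - torusChar k x‖ ^ 2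
          rw [norm_sub_rev]⟩ e =
      2 * (L : ℝ) ^ d * anisoDispersion K (latticeMomentum L k) := by
  classical
  have hL2 : 2 ≤ L := by omega
  rw [sum_edgeFinset_torusGraph hL]
  simp only [Sym2.lift_mk]
  simp_rw [bondWeight_mk_add_single hL]
  have hterm : ∀ (x : TorusSite d L) (i : Fin d),
      ‖torusChar k x - torusChar k (x + Pi.single i 1)‖ ^ 2 =
        2 * (1 - Real.cos (latticeMomentum L k i)) := by
    intro x i
    rw [torusChar_add_right, torusChar_single hL2, ← mul_one_sub, norm_mul, norm_torusChar,
      one_mul, ← Complex.normSq_eq_norm_sq, normSq_one_sub_exp_mul_I]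
  simp_rw [hterm]
  rw [Finset.sum_const, Finset.card_univ, Fintype.card_fun, ZMod.card, Fintype.card_fin]
  unfold anisoDispersion
  rw [nsmul_eq_mul, Finset.mul_sum, Finset.mul_sum]
  push_cast
  exact Finset.sum_congr rfl fun i _ => by ring

variable {ν : ℕ}

/-- `𝓔_W(f, r e_a) = 𝓔_W(f^a, r)`: the weighted vector form against a field pointing in one spin
direction is the weighted scalar form of that component; written with the complexified form at a
real function. [cite: FriedliVelenik2017, §10.5.3, proof of Thm. 10.24 (`h_j = α_j e_ℓ`)] -/
theorem wvecGradForm_planeField_right_re {V : Type*} [Fintype V] {G : SimpleGraph V}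
    [DecidableRel G.Adj] {W : Sym2 V → ℝ} (f : V → Fin ν → ℝ) (a : Fin ν) (g : V → ℂ) :
    wvecGradForm G W f (planeField a fun x => (g x).re) = (wgradFormC G W (fun x => f x a) g).re ∧
      wvecGradForm G W f (planeField a fun x => (g x).im) =
        (wgradFormC G W (fun x => f x a) g).im := by
  unfold wvecGradForm wgradFormC
  rw [Complex.re_sum, Complex.im_sum]
  constructor
  · refine Finset.sum_congr rfl fun e _ => ?_
    induction e using Sym2.ind with
    | _ x y =>
      simp only [Sym2.lift_mk, planeField]
      rw [Finset.sum_eq_single a (fun b _ hb => by simp [hb]) (fun ha => absurd (Finset.mem_univ a) ha)]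
      simp only [if_true, Complex.mul_re, Complex.ofReal_re, Complex.ofReal_im, Complex.sub_re,
        zero_mul, sub_zero]
  · refine Finset.sum_congr rfl fun e _ => ?_
    induction e using Sym2.ind with
    | _ x y =>
      simp only [Sym2.lift_mk, planeField]
      rw [Finset.sum_eq_single a (fun b _ hb => by simp [hb]) (fun ha => absurd (Finset.mem_univ a) ha)]
      simp only [if_true, Complex.mul_im, Complex.ofReal_re, Complex.ofReal_im, Complex.sub_im,
        zero_mul, add_zero]

/-- `𝓔_W(r e_a, r e_a) + 𝓔_W(s e_a, s e_a) = ∑ W‖g_x - g_y‖²` for `r = Re g`, `s = Im g`.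
[cite: FriedliVelenik2017, §10.5.3, proof of Thm. 10.24] -/
theorem wvecGradForm_planeField_re_add_im {V : Type*} [Fintype V] {G : SimpleGraph V}
    [DecidableRel G.Adj] {W : Sym2 V → ℝ} (a : Fin ν) (g : V → ℂ) :
    wvecGradForm G W (planeField a fun x => (g x).re) (planeField a fun x => (g x).re) +
        wvecGradForm G W (planeField a fun x => (g x).im) (planeField a fun x => (g x).im) =
      ∑ e ∈ G.edgeFinset, W e * Sym2.lift ⟨fun x y => ‖g x - g y‖ ^ 2, fun x y => by
          show ‖g x - g y‖ ^ 2 = ‖g y - g x‖ ^ 2; rw [norm_sub_rev]⟩ e := by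
  unfold wvecGradForm
  rw [← Finset.sum_add_distrib]
  refine Finset.sum_congr rfl fun e _ => ?_
  induction e using Sym2.ind with
  | _ x y =>
    simp only [Sym2.lift_mk, planeField]
    rw [Finset.sum_eq_single a (fun b _ hb => by simp [hb]) (fun ha => absurd (Finset.mem_univ a) ha),
      Finset.sum_eq_single a (fun b _ hb => by simp [hb]) (fun ha => absurd (Finset.mem_univ a) ha)]
    simp only [if_true]
    rw [← mul_add, ← Complex.normSq_eq_norm_sq, Complex.normSq_apply, Complex.sub_re,
      Complex.sub_im]

/-- **The anisotropic infrared bound per spin component, in weighted form** (Fröhlich–Israel–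
Lieb–Simon 1978, Thm. 4.7: `g_Λ(p) ≤ (2βE_p)⁻¹`; Friedli–Velenik 2017, proof of Thm. 10.24): with
`w(ω) = e^{-𝓔_K(ω,ω)}`, `4E_K(p_k) ∫ w(ω)|∑_x ω_x^a χ_k(x)|² dμ₀ ≤ L^d ∫ w dμ₀`, for
`E_K(p_k) > 0`. [cite: FILS1978, §4, Thm. 4.7] -/
theorem weighted_mode_bound_aniso (hL : Even L) (hL4 : 4 ≤ L) (ρ : Measure (Fin ν → ℝ))
    [IsFiniteMeasure ρ] {S : Set (Fin ν → ℝ)} (hSc : IsCompact S) (hS : ρ Sᶜ = 0) (hρ : ρ ≠ 0)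
    {K : Fin d → ℝ} (hK : ∀ i, 0 ≤ K i) (k : TorusSite d L)
    (hE : 0 < anisoDispersion K (latticeMomentum L k)) (a : Fin ν) :
    4 * anisoDispersion K (latticeMomentum L k) *
        ∫ ω, Real.exp (-wvecGradForm (torusGraph d L) (bondWeight K) ω ω) *
          ‖∑ x, (ω x a : ℂ) * torusChar k x‖ ^ 2 ∂(Measure.pi fun _ : TorusSite d L => ρ) ≤
      (L : ℝ) ^ d * ∫ ω, Real.exp (-wvecGradForm (torusGraph d L) (bondWeight K) ω ω)
        ∂(Measure.pi fun _ : TorusSite d L => ρ) := by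
  set Gr := torusGraph d L with hGr
  set W : Sym2 (TorusSite d L) → ℝ := bondWeight K with hWdef
  have hW : ∀ e, 0 ≤ W e := bondWeight_nonneg hK
  set μ₀ : Measure (TorusSite d L → Fin ν → ℝ) := Measure.pi fun _ : TorusSite d L => ρ with hμ₀
  have hL3 : 3 ≤ L := by omega
  set E : ℝ := anisoDispersion K (latticeMomentum L k) with hE'
  set h₁ : TorusSite d L → Fin ν → ℝ := planeField a (fun x => (torusChar k x).re) with hh₁
  set h₂ : TorusSite d L → Fin ν → ℝ := planeField a (fun x => (torusChar k x).im) with hh₂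
  set w : (TorusSite d L → Fin ν → ℝ) → ℝ := fun ω => Real.exp (-wvecGradForm Gr W ω ω) with hw
  set A₁ : (TorusSite d L → Fin ν → ℝ) → ℝ := fun ω => wvecGradForm Gr W ω h₁ with hA₁
  set A₂ : (TorusSite d L → Fin ν → ℝ) → ℝ := fun ω => wvecGradForm Gr W ω h₂ with hA₂
  set M : (TorusSite d L → Fin ν → ℝ) → ℂ := fun ω => ∑ x, (ω x a : ℂ) * torusChar k x with hM
  set Z₀ : ℝ := ∫ ω, w ω ∂μ₀ with hZ₀
  set X : ℝ := ∫ ω, w ω * ‖M ω‖ ^ 2 ∂μ₀ with hX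
  show 4 * E * X ≤ (L : ℝ) ^ d * Z₀
  have hGD : ∀ (h : TorusSite d L → Fin ν → ℝ) (t : ℝ), wvZ Gr W ρ (t • h) ≤ wvZ Gr W ρ 0 :=
    fun h t => wvZ_le_wvZ_zero hL hL4 ρ hSc hS hρ hK _
  have key₁ : 2 * ∫ ω, w ω * A₁ ω ^ 2 ∂μ₀ ≤ wvecGradForm Gr W h₁ h₁ * Z₀ :=
    integral_weight_wvecGradForm_sq_le (G := Gr) ρ hSc hS hρ hW h₁ (hGD h₁)
  have key₂ : 2 * ∫ ω, w ω * A₂ ω ^ 2 ∂μ₀ ≤ wvecGradForm Gr W h₂ h₂ * Z₀ :=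
    integral_weight_wvecGradForm_sq_le (G := Gr) ρ hSc hS hρ hW h₂ (hGD h₂)
  -- `A₁² + A₂² = 4E²‖M‖²`
  have hA : ∀ ω, A₁ ω ^ 2 + A₂ ω ^ 2 = 4 * E ^ 2 * ‖M ω‖ ^ 2 := by
    intro ω
    have hC := wgradFormC_torusChar_fun hL3 K k (fun x => ω x a)
    obtain ⟨hre', him'⟩ := wvecGradForm_planeField_right_re (G := Gr) (W := W) ω a (torusChar k)
    have hre : A₁ ω = 2 * E * (M ω).re := by
      rw [hA₁]
      simp only
      rw [hh₁, hre', hWdef, hC, Complex.re_ofReal_mul]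
    have him : A₂ ω = 2 * E * (M ω).im := by
      rw [hA₂]
      simp only
      rw [hh₂, him', hWdef, hC, Complex.im_ofReal_mul]
    rw [hre, him, ← Complex.normSq_eq_norm_sq, Complex.normSq_apply]
    ring
  -- `B₁ + B₂ = 2L^dE`
  have hB : wvecGradForm Gr W h₁ h₁ + wvecGradForm Gr W h₂ h₂ = 2 * (L : ℝ) ^ d * E := by
    rw [hh₁, hh₂, wvecGradForm_planeField_re_add_im]
    exact wgradNormSq_torusChar hL3 K k
  have hwc : Continuous w := (continuous_wvecGradForm_self (G := Gr) (W := W)).neg.rexp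
  have hint : ∀ {f : (TorusSite d L → Fin ν → ℝ) → ℝ}, Continuous f → Integrable f μ₀ := fun hf =>
    integrable_pi_of_continuous ρ hSc hS hf
  have hA₁c : Continuous A₁ := continuous_wvecGradForm_left (G := Gr) (W := W) h₁
  have hA₂c : Continuous A₂ := continuous_wvecGradForm_left (G := Gr) (W := W) h₂
  have hMc : Continuous M := by rw [hM]; fun_prop
  have hS' : ∫ ω, w ω * A₁ ω ^ 2 ∂μ₀ + ∫ ω, w ω * A₂ ω ^ 2 ∂μ₀ = 4 * E ^ 2 * X := by
    rw [hX, ← integral_add (hint (by fun_prop)) (hint (by fun_prop)), ← integral_const_mul]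
    refine integral_congr_ae (ae_of_all _ fun ω => ?_)
    simp only
    rw [← mul_add, hA ω]
    ring
  have hsum : 2 * (4 * E ^ 2 * X) ≤ 2 * (L : ℝ) ^ d * E * Z₀ := by
    calc 2 * (4 * E ^ 2 * X)
        = 2 * ∫ ω, w ω * A₁ ω ^ 2 ∂μ₀ + 2 * ∫ ω, w ω * A₂ ω ^ 2 ∂μ₀ := by rw [← hS', mul_add]
      _ ≤ wvecGradForm Gr W h₁ h₁ * Z₀ + wvecGradForm Gr W h₂ h₂ * Z₀ := add_le_add key₁ key₂
      _ = 2 * (L : ℝ) ^ d * E * Z₀ := by rw [← add_mul, hB]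
  have h8 : E * (4 * E * X) ≤ E * ((L : ℝ) ^ d * Z₀) := by nlinarith
  exact le_of_mul_le_mul_left h8 hE

end PlaneWaves

/-! ### The anisotropic torus model: Hamiltonian, Gibbs measure, and the bounds -/

section TorusModel

open scoped ComplexConjugate

variable {d L ν : ℕ}

/-- The ANISOTROPIC `ν`-vector Hamiltonian on the torus:
`ℋ_K(ω) = ∑_x ∑_i K_i ‖ω(x + eᵢ) - ω(x)‖₂²` (Friedli–Velenik's (10.38) with a coupling per
lattice direction, inverse temperature absorbed; Fröhlich–Israel–Lieb–Simon 1978, Thm. 4.6,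
`H = ½∑J_{αγ}(σ_α - σ_γ)²` with nearest-neighbour `J`). [cite: FILS1978, §4, Thm. 4.6] -/
def nVectorHamiltonianK [NeZero L] (K : Fin d → ℝ) (ω : VecConfig d L ν) : ℝ :=
  ∑ x : TorusSite d L, ∑ i : Fin d, K i * ∑ a : Fin ν, (ω (x + Pi.single i 1) a - ω x a) ^ 2

/-- The anisotropic Hamiltonian is nonnegative for `K ≥ 0`. [cite: FILS1978, §4, Thm. 4.6] -/
theorem nVectorHamiltonianK_nonneg [NeZero L] {K : Fin d → ℝ} (hK : ∀ i, 0 ≤ K i)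
    (ω : VecConfig d L ν) : 0 ≤ nVectorHamiltonianK K ω :=
  Finset.sum_nonneg fun _ _ => Finset.sum_nonneg fun i _ =>
    mul_nonneg (hK i) (Finset.sum_nonneg fun _ _ => sq_nonneg _)

/-- The anisotropic Hamiltonian is continuous. [cite: FILS1978, §4, Thm. 4.6] -/
theorem continuous_nVectorHamiltonianK [NeZero L] (K : Fin d → ℝ) :
    Continuous fun ω : VecConfig d L ν => nVectorHamiltonianK K ω := by
  unfold nVectorHamiltonianK
  fun_prop

/-- The anisotropic Hamiltonian is the weighted vector bond form of the torus graph with the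
direction-dependent bond weight (`L ≥ 3`). [cite: FILS1978, §4, Thm. 4.6] -/
theorem nVectorHamiltonianK_eq_wvecGradForm [NeZero L] (hL : 3 ≤ L) (K : Fin d → ℝ)
    (ω : VecConfig d L ν) :
    nVectorHamiltonianK K ω = wvecGradForm (torusGraph d L) (bondWeight K) ω ω := by
  unfold nVectorHamiltonianK wvecGradForm
  rw [sum_edgeFinset_torusGraph hL]
  refine Finset.sum_congr rfl fun x _ => Finset.sum_congr rfl fun i _ => ?_
  simp only [Sym2.lift_mk]
  rw [bondWeight_mk_add_single hL]
  exact congrArg _ (Finset.sum_congr rfl fun a _ => by ring)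

/-- The partition function `Z_K = ∫ e^{-ℋ_K} dμ₀` of the anisotropic model.
[cite: FILS1978, §4, Thm. 4.6] -/
def nVectorPartitionFunctionK [NeZero L] (ρ : Measure (Fin ν → ℝ)) (K : Fin d → ℝ) : ℝ :=
  ∫ ω, Real.exp (-nVectorHamiltonianK K ω) ∂(nVectorRef (d := d) (L := L) ρ)

/-- The **Gibbs distribution** `μ_K = Z_K⁻¹ e^{-ℋ_K} μ₀` of the anisotropic `ν`-vector model on
the torus. [cite: FILS1978, §4, (4.6) (the state `⟨·⟩_{β,Λ}`)] -/
def nVectorGibbsK [NeZero L] (ρ : Measure (Fin ν → ℝ)) (K : Fin d → ℝ) :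
    Measure (VecConfig d L ν) :=
  (ENNReal.ofReal (nVectorPartitionFunctionK (d := d) (L := L) ρ K))⁻¹ •
    (nVectorRef (d := d) (L := L) ρ).withDensity
      fun ω => ENNReal.ofReal (Real.exp (-nVectorHamiltonianK K ω))

/-- The Boltzmann weight of the anisotropic model is integrable against the finite reference
measure (`K ≥ 0`). [cite: FILS1978, §4, Thm. 4.6] -/
theorem integrable_exp_neg_nVectorHamiltonianK [NeZero L] (ρ : Measure (Fin ν → ℝ))
    [IsFiniteMeasure ρ] {K : Fin d → ℝ} (hK : ∀ i, 0 ≤ K i) :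
    Integrable (fun ω : VecConfig d L ν => Real.exp (-nVectorHamiltonianK K ω))
      (nVectorRef (d := d) (L := L) ρ) := by
  refine (integrable_const (1 : ℝ)).mono' ?_ (ae_of_all _ fun ω => ?_)
  · exact ((continuous_nVectorHamiltonianK K).neg.rexp).aestronglyMeasurable
  · rw [Real.norm_eq_abs, abs_of_pos (Real.exp_pos _), Real.exp_le_one_iff, neg_nonpos]
    exact nVectorHamiltonianK_nonneg hK ω

/-- The anisotropic partition function is positive (`ρ ≠ 0` finite, `K ≥ 0`).
[cite: FILS1978, §4, Thm. 4.6] -/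
theorem nVectorPartitionFunctionK_pos [NeZero L] (ρ : Measure (Fin ν → ℝ)) [IsFiniteMeasure ρ]
    (hρ : ρ ≠ 0) {K : Fin d → ℝ} (hK : ∀ i, 0 ≤ K i) :
    0 < nVectorPartitionFunctionK (d := d) (L := L) ρ K := by
  unfold nVectorPartitionFunctionK nVectorRef
  haveI : NeZero (Measure.pi fun _ : TorusSite d L => ρ) := ⟨pi_ne_zero ρ hρ⟩
  exact integral_exp_pos (integrable_exp_neg_nVectorHamiltonianK ρ hK)

/-- The anisotropic Gibbs distribution is a probability measure (`ρ ≠ 0` finite, `K ≥ 0`).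
[cite: FILS1978, §4, (4.6)] -/
theorem isProbabilityMeasure_nVectorGibbsK [NeZero L] (ρ : Measure (Fin ν → ℝ))
    [IsFiniteMeasure ρ] (hρ : ρ ≠ 0) {K : Fin d → ℝ} (hK : ∀ i, 0 ≤ K i) :
    IsProbabilityMeasure (nVectorGibbsK (d := d) (L := L) ρ K) := by
  constructor
  have hZ := nVectorPartitionFunctionK_pos (d := d) (L := L) ρ hρ hK
  rw [nVectorGibbsK, Measure.smul_apply, withDensity_apply _ MeasurableSet.univ,
    Measure.restrict_univ, ← ofReal_integral_eq_lintegral_ofReal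
      (integrable_exp_neg_nVectorHamiltonianK ρ hK) (ae_of_all _ fun ω => (Real.exp_pos _).le),
    smul_eq_mul]
  exact ENNReal.inv_mul_cancel (ENNReal.ofReal_pos.2 hZ).ne' ENNReal.ofReal_ne_top

/-- **Gibbs expectations of the anisotropic model as weighted `μ₀`-averages**:
`⟨F⟩_K = Z_K⁻¹ ∫ e^{-ℋ_K(ω)} F(ω) dμ₀(ω)`. [cite: FILS1978, §4, (4.6)] -/
theorem integral_nVectorGibbsK [NeZero L] (ρ : Measure (Fin ν → ℝ)) [IsFiniteMeasure ρ]
    (hρ : ρ ≠ 0) {K : Fin d → ℝ} (hK : ∀ i, 0 ≤ K i) (F : VecConfig d L ν → ℝ) :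
    ∫ ω, F ω ∂(nVectorGibbsK (d := d) (L := L) ρ K) =
      (∫ ω, Real.exp (-nVectorHamiltonianK K ω) * F ω ∂(nVectorRef (d := d) (L := L) ρ)) /
        nVectorPartitionFunctionK (d := d) (L := L) ρ K := by
  have hZ := nVectorPartitionFunctionK_pos (d := d) (L := L) ρ hρ hK
  have hmeas : Measurable fun ω : VecConfig d L ν =>
      ENNReal.ofReal (Real.exp (-nVectorHamiltonianK K ω)) :=
    ((continuous_nVectorHamiltonianK K).neg.rexp).measurable.ennreal_ofReal
  rw [nVectorGibbsK, integral_smul_measure, integral_withDensity_eq_integral_toReal_smul hmeas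
      (ae_of_all _ fun _ => ENNReal.ofReal_lt_top)]
  simp_rw [ENNReal.toReal_ofReal (Real.exp_pos _).le, smul_eq_mul]
  rw [ENNReal.toReal_inv, ENNReal.toReal_ofReal hZ.le, div_eq_inv_mul]

/-- **Infrared bound and finite-volume long-range order for the ANISOTROPIC `ν`-vector model**
(Fröhlich–Israel–Lieb–Simon 1978, §4, (4.6)–(4.10) and Thm. 4.7: "`Z(h_α) ≤ Z(0)` and
`g_Λ(p) ≤ (2βE_p)⁻¹` with `E_p` depending on `J_{αγ}`"; the isotropic case is Friedli–Velenik
2017, Thm. 10.24). For the Gibbs distribution `μ_K` of `ℋ_K = ∑_{(x,i)} K_i‖S_{x+eᵢ} - S_x‖²` on the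
torus `(ℤ/Lℤ)^d`, `L` even, `L ≥ 4`, couplings `K_i ≥ 0`, and a nonzero finite compactly supported
single-spin measure `ρ` on `ℝ^ν`:
(1) INFRARED BOUND: for every mode `k` with `E_K(p_k) > 0`, `p_k = 2πk/L`,
`|𝕋_L|⁻¹⟨‖∑_x e^{-ip·x} S_x‖₂²⟩_K ≤ ν/(4E_K(p_k))`, `E_K(p) = ∑ᵢ K_i(1 - cos pᵢ)`;
(2) LONG-RANGE-ORDER BOUND: if all `K_i > 0` and `‖S‖₂ = 1` `ρ`-a.s., then
`⟨‖m_L‖₂²⟩_K ≥ 1 - (ν/4)|𝕋_L|⁻¹∑_{k ≠ 0} E_K(p_k)⁻¹` ((4.10)). [cite: FILS1978, §4, (4.6)–(4.10) and Thm. 4.7] -/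
theorem nVectorK_infraredBound [NeZero L] (hL : Even L) (hL4 : 4 ≤ L)
    (ρ : Measure (Fin ν → ℝ)) [IsFiniteMeasure ρ] {S : Set (Fin ν → ℝ)} (hSc : IsCompact S)
    (hS : ρ Sᶜ = 0) (hρ : ρ ≠ 0) {K : Fin d → ℝ} (hK : ∀ i, 0 ≤ K i) :
    (∀ k : TorusSite d L, 0 < anisoDispersion K (latticeMomentum L k) →
      (1 / (L : ℝ) ^ d) * ∫ ω, spinFourierNormSq ω k ∂(nVectorGibbsK (d := d) (L := L) ρ K) ≤
        ν / (4 * anisoDispersion K (latticeMomentum L k))) ∧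
    ((∀ i, 0 < K i) → (∀ᵐ s ∂ρ, ∑ a, s a ^ 2 = 1) →
      1 - ν / 4 * ((1 / (L : ℝ) ^ d) *
          ∑ k ∈ (Finset.univ.erase (0 : TorusSite d L)),
            1 / anisoDispersion K (latticeMomentum L k)) ≤
        ∫ ω, magnetisationNormSq ω ∂(nVectorGibbsK (d := d) (L := L) ρ K)) := by
  have hL3 : 3 ≤ L := by omega
  have hL0 : (0 : ℝ) < (L : ℝ) ^ d := pow_pos (Nat.cast_pos.2 (Nat.pos_of_ne_zero (NeZero.ne L))) d
  set μ₀ : Measure (VecConfig d L ν) := nVectorRef (d := d) (L := L) ρ with hμ₀def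
  have hμ₀pi : μ₀ = Measure.pi fun _ : TorusSite d L => ρ := rfl
  set Z : ℝ := nVectorPartitionFunctionK (d := d) (L := L) ρ K with hZdef
  have hZpos : 0 < Z := nVectorPartitionFunctionK_pos (d := d) (L := L) ρ hρ hK
  set w : VecConfig d L ν → ℝ := fun ω => Real.exp (-nVectorHamiltonianK K ω) with hw
  have hw_eq : ∀ ω, w ω = Real.exp (-wvecGradForm (torusGraph d L) (bondWeight K) ω ω) :=
    fun ω => by
      rw [hw]
      simp only
      rw [nVectorHamiltonianK_eq_wvecGradForm hL3]
  have hZ_eq : Z = ∫ ω, w ω ∂μ₀ := rfl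
  have hwc : Continuous w := (continuous_nVectorHamiltonianK K).neg.rexp
  have hint : ∀ {f : VecConfig d L ν → ℝ}, Continuous f → Integrable f μ₀ := fun hf =>
    integrable_pi_of_continuous ρ hSc hS hf
  have clause1 : ∀ k : TorusSite d L, 0 < anisoDispersion K (latticeMomentum L k) →
      (1 / (L : ℝ) ^ d) * ((∫ ω, w ω * spinFourierNormSq ω k ∂μ₀) / Z) ≤
        ν / (4 * anisoDispersion K (latticeMomentum L k)) := by
    intro k hEpos
    set E := anisoDispersion K (latticeMomentum L k) with hE
    have hcomp : ∀ a : Fin ν, 4 * E *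
        ∫ ω, w ω * ‖torusFourier (fun x => (ω x a : ℂ)) k‖ ^ 2 ∂μ₀ ≤ (L : ℝ) ^ d * Z := by
      intro a
      have h := weighted_mode_bound_aniso hL hL4 ρ hSc hS hρ hK k hEpos a
      rw [hZ_eq, hμ₀pi]
      simp_rw [hw_eq, ← norm_sum_mul_torusChar]
      exact h
    have hsum : 4 * E * ∫ ω, w ω * spinFourierNormSq ω k ∂μ₀ ≤ ν * ((L : ℝ) ^ d * Z) := by
      have hsplit : ∫ ω, w ω * spinFourierNormSq ω k ∂μ₀ =
          ∑ a : Fin ν, ∫ ω, w ω * ‖torusFourier (fun x => (ω x a : ℂ)) k‖ ^ 2 ∂μ₀ := by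
        unfold spinFourierNormSq
        simp_rw [Finset.mul_sum]
        rw [integral_finsetSum _ fun a _ => hint (by fun_prop)]
      rw [hsplit, Finset.mul_sum]
      calc ∑ a : Fin ν, 4 * E * ∫ ω, w ω * ‖torusFourier (fun x => (ω x a : ℂ)) k‖ ^ 2 ∂μ₀
          ≤ ∑ _a : Fin ν, (L : ℝ) ^ d * Z := Finset.sum_le_sum fun a _ => hcomp a
        _ = ν * ((L : ℝ) ^ d * Z) := by
            rw [Finset.sum_const, Finset.card_univ, Fintype.card_fin, nsmul_eq_mul]
    rw [div_mul_div_comm, one_mul, div_le_div_iff₀ (by positivity) (by positivity)]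
    linarith [hsum]
  refine ⟨fun k hk => ?_, fun hKpos hnorm => ?_⟩
  · rw [integral_nVectorGibbsK ρ hρ hK]
    exact clause1 k hk
  · have hae : ∀ᵐ ω ∂μ₀, ∀ x, ∑ a, ω x a ^ 2 = 1 :=
      ae_pi_forall (ι := TorusSite d L) ρ hnorm
    have hmag : ∫ ω, w ω * magnetisationNormSq ω ∂μ₀ =
        Z - (1 / (L : ℝ) ^ d) ^ 2 * ∑ k ∈ Finset.univ.erase (0 : TorusSite d L),
          ∫ ω, w ω * spinFourierNormSq ω k ∂μ₀ := by
      have h1 : ∫ ω, w ω * magnetisationNormSq ω ∂μ₀ =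
          ∫ ω, (w ω - (1 / (L : ℝ) ^ d) ^ 2 * ∑ k ∈ Finset.univ.erase (0 : TorusSite d L),
            w ω * spinFourierNormSq ω k) ∂μ₀ := by
        refine integral_congr_ae ?_
        filter_upwards [hae] with ω hω
        rw [magnetisationNormSq_eq ω hω, mul_sub, mul_one, Finset.mul_sum, Finset.mul_sum,
          Finset.mul_sum]
        congr 1
        exact Finset.sum_congr rfl fun k _ => by ring
      have h2 : Integrable (fun ω => (1 / (L : ℝ) ^ d) ^ 2 *
          ∑ k ∈ Finset.univ.erase (0 : TorusSite d L), w ω * spinFourierNormSq ω k) μ₀ :=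
        hint (by fun_prop)
      rw [h1, integral_sub (hint (by fun_prop)) h2, integral_const_mul,
        integral_finsetSum _ fun k _ => hint (by fun_prop), hZ_eq]
    have hbound : ∑ k ∈ Finset.univ.erase (0 : TorusSite d L),
        (1 / (L : ℝ) ^ d) ^ 2 * (∫ ω, w ω * spinFourierNormSq ω k ∂μ₀) / Z ≤
          ν / 4 * ((1 / (L : ℝ) ^ d) *
            ∑ k ∈ Finset.univ.erase (0 : TorusSite d L),
              1 / anisoDispersion K (latticeMomentum L k)) := by
      rw [Finset.mul_sum, Finset.mul_sum]
      refine Finset.sum_le_sum fun k hkT => ?_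
      have hk : k ≠ 0 := Finset.ne_of_mem_erase hkT
      have hEk := anisoDispersion_latticeMomentum_pos hKpos hk
      have h1 := clause1 k hEk
      have e1 : (1 / (L : ℝ) ^ d) ^ 2 * (∫ ω, w ω * spinFourierNormSq ω k ∂μ₀) / Z =
          (1 / (L : ℝ) ^ d) * (1 / (L : ℝ) ^ d * ((∫ ω, w ω * spinFourierNormSq ω k ∂μ₀) / Z)) := by
        ring
      have e2 : (ν : ℝ) / 4 * (1 / (L : ℝ) ^ d *
          (1 / anisoDispersion K (latticeMomentum L k))) =
          (1 / (L : ℝ) ^ d) * (ν / (4 * anisoDispersion K (latticeMomentum L k))) := by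
        field_simp
      rw [e1, e2]
      exact mul_le_mul_of_nonneg_left h1 (by positivity)
    calc 1 - ν / 4 * ((1 / (L : ℝ) ^ d) *
          ∑ k ∈ Finset.univ.erase (0 : TorusSite d L), 1 / anisoDispersion K (latticeMomentum L k))
        ≤ 1 - ∑ k ∈ Finset.univ.erase (0 : TorusSite d L),
            (1 / (L : ℝ) ^ d) ^ 2 * (∫ ω, w ω * spinFourierNormSq ω k ∂μ₀) / Z := by linarith
      _ = (∫ ω, w ω * magnetisationNormSq ω ∂μ₀) / Z := by
          rw [hmag, sub_div, div_self hZpos.ne', Finset.mul_sum, Finset.sum_div]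
      _ = ∫ ω, magnetisationNormSq ω ∂(nVectorGibbsK (d := d) (L := L) ρ K) :=
          (integral_nVectorGibbsK ρ hρ hK _).symm

end TorusModel

end NVector

end Literature.Probability.LatticeModels
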